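import Literature.NumberTheory.LFunctions.ConreyIwaniec2002AFEDefs
import Literature.NumberTheory.LFunctions.ClassGroupXi
import Literature.NumberTheory.LFunctions.ClassTwistedZetaMeanSquare
import Literature.NumberTheory.LFunctions.ClassGroupCharacterTwist
import Mathlib.Analysis.SpecialFunctions.Gaussian.GaussianIntegral
import HarnessLib

/-!
# Conrey–Iwaniec (2002), Proposition 7.1 — part I: the line `Re u = 1`

B. Conrey, H. Iwaniec, *Spacing of zeros of Hecke L-functions and the class number problem*,
Acta Arith. 103 (2002), §7, Proposition 7.1 (7.12)–(7.14) [held text `paper:arxiv-math_0111012`,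
p0017]. Support file (everything PROVED; no definitions, no named facts) for the exact
"approximate functional equation" of the class group `L`-functions `L(s, ψ)` of `K = ℚ(√−q)` in the
typed form of `ConreyIwaniec2002AFEDefs.lean` (`afeG = e^{u²}`, `afeV`, `afeA`, `afeR`), used by the
kernel line `prop81-afe-plancherel` (Proposition 8.1, cell landau-siegel / ls-inputs, stub S1).

Contents:
* `dedekindGammaFactor_eq_condQ` — for `[K:ℚ] = 2`, `d_K = −q`: `γ_K(w) = 2·Q^w·Γ(w)` with
  `Q = √q/2π` (`condQ`), i.e. the tree's `|d_K|^{w/2}Γ_ℂ(w)` is the paper's `Q^wΓ(w)` (7.6) up to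
  the constant factor `2` (which cancels from every statement of §7);
* `twistCount_inv`, `afeV_conj`, `afeA_inv_conj` — `λ_{ψ⁻¹} = conj λ_ψ`, `V(s̄,y) = conj V(s,y)`,
  hence the dual sum `A_{ψ⁻¹}(s̄) = conj A_ψ(s)` (the second sum of (7.12) on `Re s = ½`);
* majorants / continuity / integrability of the integrand of `V_s(y)` on `u = 1 + iv`
  (`|Γ(s+1+iv)| ≤ Γ(Re s+1)`, `|G(1+iv)| = e^{1−v²}`), `integral_afeV_integrand`;
* `integral_lineOne` — **the unfolding on `Re u = 1`**: for `Re s > 0`,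
  `∫ ξ(s+u,ψ)/((s+u)(s+u−1)) · G(u) u^{−1} dv = 2π · γ_K(s) · A_ψ(s)` (`u = 1+iv`), where
  `ξ(w,ψ)/(w(w−1)) = γ_K(w)L(w,ψ)` (the tree's entire `classXi`): the Dirichlet series
  `L(w,ψ) = Σ λ_ψ(n)n^{−w}` (`LSeries_twistCount_classGroupCharIdealHom`, `Re w = Re s + 1 > 1`) is
  integrated termwise (`integral_tsum_of_summable_integral_norm`) against the Gaussian majorant.

Part II (`ConreyIwaniec2002AFE.lean`) shifts the line to `Re u = −1` and assembles Proposition 7.1.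

«The programme SEARCHES and TYPES; no claim about Landau–Siegel zeros, Theorems 1–2 of
arXiv:2211.02515 or a repaired Margin232 until a kernel theorem says so.»

## References
* [ConreyIwaniec2002] B. Conrey, H. Iwaniec, Acta Arith. 103 (2002) 259–312, arXiv:math/0111012,
  §7 (7.1), (7.6), (7.9)–(7.14), Proposition 7.1.
-/

noncomputable section

open scoped NumberField ComplexConjugate
open Complex MeasureTheory Filter Topology Set

namespace Literature.NumberTheory.LFunctions

namespace ConreyIwaniec2002

open NumberField Literature.NumberTheory.LFunctions.NumberField

/-! ## The test function `G(u) = e^{u²}` -/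

/-- `G` is continuous. [folklore] -/
private theorem continuous_afeG : Continuous afeG := differentiable_afeG.continuous

/-! ## The gamma factor of `ℚ(√−q)`: `γ_K(w) = 2 Q^w Γ(w)`, `Q = √q/2π` -/

/-- `Q^w = q^{w/2} (2π)^{−w}` for `Q = √q/2π`. [cite: ConreyIwaniec2002, §7 (7.6)] -/
theorem condQ_cpow {q : ℕ} (hq : 0 < q) (w : ℂ) :
    (condQ q : ℂ) ^ w = (q : ℂ) ^ (w / 2) * (2 * (Real.pi : ℂ)) ^ (-w) := by
  have hQ : 0 < condQ q := condQ_pos hq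
  have hq' : (0 : ℝ) < q := by exact_mod_cast hq
  have h2π : (0 : ℝ) < 2 * Real.pi := by positivity
  have e1 : (condQ q : ℂ) ^ w = Complex.exp (Real.log (condQ q) * w) := by
    rw [Complex.cpow_def_of_ne_zero (by exact_mod_cast hQ.ne'), ← Complex.ofReal_log hQ.le]
  have e2 : (q : ℂ) ^ (w / 2) = Complex.exp (Real.log q * (w / 2)) := by
    rw [Complex.cpow_def_of_ne_zero (by exact_mod_cast hq.ne'), ← Complex.ofReal_natCast,
      ← Complex.ofReal_log hq'.le]
  have e3 : (2 * (Real.pi : ℂ)) ^ (-w) = Complex.exp (Real.log (2 * Real.pi) * (-w)) := by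
    rw [show (2 * (Real.pi : ℂ)) = ((2 * Real.pi : ℝ) : ℂ) by push_cast; ring,
      Complex.cpow_def_of_ne_zero (by exact_mod_cast h2π.ne'), ← Complex.ofReal_log h2π.le]
  rw [e1, e2, e3, ← Complex.exp_add]
  congr 1
  have hlog : Real.log (condQ q) = Real.log q / 2 - Real.log (2 * Real.pi) := by
    rw [condQ, Real.log_div (Real.sqrt_pos.mpr hq').ne' h2π.ne', Real.log_sqrt hq'.le]
  rw [hlog]
  push_cast
  ring

/-- **`γ_K(w) = 2 Q^w Γ(w)`** for `K` imaginary quadratic with `d_K = −q`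
(`γ_K = |d_K|^{w/2} Γ_ℂ(w)`, `Γ_ℂ(w) = 2(2π)^{−w}Γ(w)`, so `Λ_K = 2·Q^wΓ(w)L` — the paper's
`Λ(s) = Q^sΓ(s)L(s)` (7.6) up to the harmless factor `2`). [cite: ConreyIwaniec2002, §7 (7.6)] -/
theorem dedekindGammaFactor_eq_condQ (K : Type) [Field K] [NumberField K] {q : ℕ}
    (h2 : Module.finrank ℚ K = 2) (hdisc : NumberField.discr K = -(q : ℤ)) (w : ℂ) :
    dedekindGammaFactor K w = 2 * (condQ q : ℂ) ^ w * Complex.Gamma w := by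
  have hq : 0 < q := by
    rcases Nat.eq_zero_or_pos q with h | h
    · exfalso; exact NumberField.discr_ne_zero K (by rw [hdisc, h]; simp)
    · exact h
  have hd : NumberField.discr K < 0 := by rw [hdisc]; simp [hq]
  have hnat : (NumberField.discr K).natAbs = q := by rw [hdisc]; simp
  rw [dedekindGammaFactor_eq_of_discr_neg h2 hd, hnat, Complex.Gammaℂ_def, condQ_cpow hq]
  ring

/-! ## Conjugation symmetries: `λ_{ψ⁻¹} = conj λ_ψ`, `V(s̄, y) = conj V(s, y)` -/

variable {K : Type} [Field K] [NumberField K]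

/-- `ν_{ψ⁻¹}(𝔞) = conj ν_ψ(𝔞)` (class group characters are unitary: the coefficients `λ` of (7.1)
for `ψ⁻¹ = ψ̄`). [cite: ConreyIwaniec2002, §7 (7.1)] -/
theorem classGroupCharIdealHom_inv_apply (ψ : ClassGroup (𝓞 K) →* ℂˣ) (I : Ideal (𝓞 K)) :
    classGroupCharIdealHom ψ⁻¹ I = conj (classGroupCharIdealHom ψ I) := by
  by_cases hI : I = ⊥
  · rw [hI, classGroupCharIdealHom_bot, classGroupCharIdealHom_bot, map_zero]
  · rw [classGroupCharIdealHom_apply_of_ne_bot _ hI, classGroupCharIdealHom_apply_of_ne_bot _ hI,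
      MonoidHom.inv_apply, Units.val_inv_eq_inv_val]
    exact Complex.inv_eq_conj (norm_classGroupChar_apply ψ _)

/-- **`λ_{ψ⁻¹}(n) = conj λ_ψ(n)`**. [cite: ConreyIwaniec2002, §7 (7.1)] -/
theorem twistCount_inv (ψ : ClassGroup (𝓞 K) →* ℂˣ) (n : ℕ) :
    twistCount K (classGroupCharIdealHom ψ⁻¹) n = conj (twistCount K (classGroupCharIdealHom ψ) n) := by
  unfold twistCount
  rw [map_sum]
  exact Finset.sum_congr rfl fun I _ ↦ classGroupCharIdealHom_inv_apply ψ I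

/-- The integrand of `V_s(y)` (7.14) on `u = 1 + iv`. [cite: ConreyIwaniec2002, Proposition 7.1 (7.14)] -/
theorem afeV_eq (s : ℂ) (y : ℝ) : afeV s y = (1 / (2 * Real.pi) : ℂ) *
    ∫ v : ℝ, Complex.Gamma (s + (1 + v * I)) / Complex.Gamma s *
      afeG (1 + v * I) * (y : ℂ) ^ (-(1 + v * I)) / (1 + v * I) := rfl

/-- Conjugating the integrand of `V_s(y)` reflects `v ↦ −v` and `s ↦ s̄`. [folklore] -/
private theorem conj_afeV_integrand (s : ℂ) {y : ℝ} (hy : 0 ≤ y) (v : ℝ) :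
    conj (Complex.Gamma (s + (1 + v * I)) / Complex.Gamma s *
        afeG (1 + v * I) * (y : ℂ) ^ (-(1 + v * I)) / (1 + v * I)) =
      Complex.Gamma (conj s + (1 + ((-v : ℝ) : ℂ) * I)) / Complex.Gamma (conj s) *
        afeG (1 + ((-v : ℝ) : ℂ) * I) * (y : ℂ) ^ (-(1 + ((-v : ℝ) : ℂ) * I)) /
          (1 + ((-v : ℝ) : ℂ) * I) := by
  have hu : conj (1 + (v : ℂ) * I) = 1 + ((-v : ℝ) : ℂ) * I := by
    simp [map_add, map_mul, Complex.conj_ofReal, Complex.conj_I]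
  have hy' : ((y : ℂ)).arg ≠ Real.pi := by
    rw [Complex.arg_ofReal_of_nonneg hy]; exact Real.pi_pos.ne
  have hcpow : conj ((y : ℂ) ^ (-(1 + (v : ℂ) * I))) = (y : ℂ) ^ (-(1 + ((-v : ℝ) : ℂ) * I)) := by
    have := Complex.cpow_conj (y : ℂ) (-(1 + (v : ℂ) * I)) hy'
    rw [Complex.conj_ofReal] at this
    rw [← this, map_neg, hu]
  rw [map_div₀, map_mul, map_mul, map_div₀, ← Complex.Gamma_conj, ← Complex.Gamma_conj, map_add,
    hu, ← afeG_conj, hu, hcpow]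

/-- **`V(s̄, y) = conj V(s, y)`** for `y ≥ 0` (`Γ(z̄) = conj Γ(z)`, `G(ū) = conj G(u)`, `y` real; the
reflection `v ↦ −v` of the line `u = 1 + iv`). [cite: ConreyIwaniec2002, Proposition 7.1 (7.14)] -/
theorem afeV_conj (s : ℂ) {y : ℝ} (hy : 0 ≤ y) : afeV (conj s) y = conj (afeV s y) := by
  rw [afeV_eq, afeV_eq, map_mul, ← integral_conj]
  have hc : conj (1 / (2 * Real.pi) : ℂ) = (1 / (2 * Real.pi) : ℂ) := by
    simp [Complex.conj_ofReal, map_ofNat]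
  rw [hc]
  congr 1
  simp_rw [conj_afeV_integrand s hy]
  exact (integral_neg_eq_self (μ := volume)
    (fun v : ℝ ↦ Complex.Gamma (conj s + (1 + (v : ℂ) * I)) / Complex.Gamma (conj s) *
      afeG (1 + (v : ℂ) * I) * (y : ℂ) ^ (-(1 + (v : ℂ) * I)) / (1 + (v : ℂ) * I))).symm

/-- **The dual sum is `conj A(s)` on the critical line**: `A_{ψ⁻¹}(s̄) = conj A_ψ(s)`
(termwise: `λ_{ψ⁻¹}(n) = conj λ_ψ(n)`, `V(s̄,y) = conj V(s,y)`, `n^{−s̄} = conj n^{−s}`).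
[cite: ConreyIwaniec2002, Proposition 7.1 (7.12)] -/
theorem afeA_inv_conj (ψ : ClassGroup (𝓞 K) →* ℂˣ) (q : ℕ) (s : ℂ) :
    afeA K ψ⁻¹ q (conj s) = conj (afeA K ψ q s) := by
  rw [afeA, afeA, LSeries, LSeries, Complex.conj_tsum]
  refine tsum_congr fun n ↦ ?_
  rcases Nat.eq_zero_or_pos n with rfl | hn
  · simp [LSeries.term_zero]
  · have hn' : n ≠ 0 := hn.ne'
    have hQ : 0 ≤ (n : ℝ) / condQ q := by
      rcases Nat.eq_zero_or_pos q with rfl | hq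
      · simp [condQ]
      · exact div_nonneg n.cast_nonneg (condQ_pos hq).le
    rw [LSeries.term_of_ne_zero hn', LSeries.term_of_ne_zero hn', map_div₀, map_mul,
      twistCount_inv, afeV_conj s hQ]
    congr 1
    have harg : ((n : ℂ)).arg ≠ Real.pi := by
      rw [← Complex.ofReal_natCast, Complex.arg_ofReal_of_nonneg n.cast_nonneg]; exact Real.pi_pos.ne
    have := Complex.cpow_conj (n : ℂ) s harg
    rw [Complex.conj_natCast] at this
    exact this


/-! ## The line `Re u = 1`: majorants and the unfolding `∫ Λ(s+u) G(u) du/u = 2π γ_K(s) A(s)` -/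

/-- `‖Γ(s + 1 + iv)‖ ≤ Γ(Re s + 1)` for `Re s > −1`. [folklore] -/
private theorem norm_Gamma_add_one_line_le {s : ℂ} (hs : -1 < s.re) (v : ℝ) :
    ‖Complex.Gamma (s + (1 + v * I))‖ ≤ Real.Gamma (s.re + 1) := by
  have h : s + (1 + v * I) = ((s.re + 1 : ℝ) : ℂ) + ((s.im + v : ℝ) : ℂ) * I := by
    apply Complex.ext <;> simp
  rw [h]
  exact _root_.Literature.Analysis.SpecialFunctions.GammaVert.norm_Gamma_le_Gamma_re (by linarith) _

/-- `v ↦ Γ(s + 1 + iv)` is continuous for `Re s > −1` (no pole on the line). [folklore] -/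
private theorem continuous_Gamma_add_one_line {s : ℂ} (hs : -1 < s.re) :
    Continuous fun v : ℝ ↦ Complex.Gamma (s + (1 + v * I)) := by
  refine continuous_iff_continuousAt.2 fun v ↦ ?_
  have hd := Complex.differentiableAt_Gamma (s + (1 + v * I)) (fun m h ↦ by
    have := congrArg Complex.re h
    simp at this
    have hm : (0 : ℝ) ≤ m := m.cast_nonneg
    linarith)
  have hc : Continuous fun v : ℝ ↦ s + (1 + (v : ℂ) * I) := by fun_prop
  exact ContinuousAt.comp (f := fun v : ℝ ↦ s + (1 + (v : ℂ) * I)) hd.continuousAt hc.continuousAt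

/-- `1 + iv ≠ 0`. [folklore] -/
private theorem one_add_mul_I_ne_zero (v : ℝ) : (1 : ℂ) + v * I ≠ 0 := by
  intro h; have := congrArg Complex.re h; simp at this

/-- `1 ≤ ‖1 + iv‖`. [folklore] -/
private theorem one_le_norm_one_add_mul_I (v : ℝ) : 1 ≤ ‖(1 : ℂ) + v * I‖ := by
  have := Complex.abs_re_le_norm ((1 : ℂ) + v * I)
  simpa using this

/-- `((X⁻¹) : ℂ)^{−w} = X^w` for `X > 0`. [folklore] -/
private theorem inv_ofReal_cpow_neg {X : ℝ} (hX : 0 < X) (w : ℂ) : ((X⁻¹ : ℝ) : ℂ) ^ (-w) = (X : ℂ) ^ w := by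
  have harg : ((X : ℂ)).arg ≠ Real.pi := by
    rw [Complex.arg_ofReal_of_nonneg hX.le]; exact Real.pi_pos.ne
  rw [Complex.ofReal_inv, Complex.inv_cpow _ _ harg, Complex.cpow_neg, inv_inv]

/-- `(a/X)^{−w} = a^{−w} X^{w}` for `a ≥ 0`, `X > 0`. [folklore] -/
private theorem div_ofReal_cpow_neg {a X : ℝ} (ha : 0 ≤ a) (hX : 0 < X) (w : ℂ) :
    ((a / X : ℝ) : ℂ) ^ (-w) = (a : ℂ) ^ (-w) * (X : ℂ) ^ w := by
  rw [div_eq_mul_inv, Complex.ofReal_mul, Complex.mul_cpow_ofReal_nonneg ha (inv_nonneg.2 hX.le),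
    inv_ofReal_cpow_neg hX]

/-- The integrand of `V_s(y)` (7.14) is continuous in `v` (`Re s > −1`, `y > 0`).
[cite: ConreyIwaniec2002, Proposition 7.1 (7.14)] -/
theorem continuous_afeV_integrand {s : ℂ} (hs : -1 < s.re) {y : ℝ} (hy : 0 < y) :
    Continuous fun v : ℝ ↦ Complex.Gamma (s + (1 + v * I)) / Complex.Gamma s *
      afeG (1 + v * I) * (y : ℂ) ^ (-(1 + v * I)) / (1 + v * I) := by
  have h1 := continuous_Gamma_add_one_line hs
  have h2 : Continuous fun v : ℝ ↦ afeG (1 + v * I) := continuous_afeG.comp (by fun_prop)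
  have h3 : Continuous fun v : ℝ ↦ (y : ℂ) ^ (-(1 + (v : ℂ) * I)) :=
    Continuous.const_cpow (by fun_prop) (Or.inl (by exact_mod_cast hy.ne'))
  refine Continuous.div ?_ (by fun_prop) one_add_mul_I_ne_zero
  exact ((h1.div_const _).mul h2).mul h3

/-- **Majorant of the integrand of `V_s(y)`**: `≤ Γ(Re s+1)/|Γ(s)| · e · y⁻¹ · e^{−v²}`
(`|Γ(s+1+iv)| ≤ Γ(Re s+1)`, `|G(1+iv)| = e^{1−v²}`, `|y^{−u}| = y^{−1}`, `|u| ≥ 1`).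
[cite: ConreyIwaniec2002, Proposition 7.1 (7.14)] -/
theorem norm_afeV_integrand_le {s : ℂ} (hs : -1 < s.re) {y : ℝ} (hy : 0 < y) (v : ℝ) :
    ‖Complex.Gamma (s + (1 + v * I)) / Complex.Gamma s * afeG (1 + v * I) *
        (y : ℂ) ^ (-(1 + v * I)) / (1 + v * I)‖ ≤
      Real.Gamma (s.re + 1) / ‖Complex.Gamma s‖ * Real.exp 1 * y⁻¹ * Real.exp (-v ^ 2) := by
  have hG : ‖afeG (1 + v * I)‖ = Real.exp (1 - v ^ 2) := by simpa using norm_afeG 1 v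
  have hy' : ‖(y : ℂ) ^ (-(1 + (v : ℂ) * I))‖ = y⁻¹ := by
    rw [Complex.norm_cpow_eq_rpow_re_of_pos hy]
    simp [Real.rpow_neg_one]
  have hu := one_le_norm_one_add_mul_I v
  have hΓ := norm_Gamma_add_one_line_le hs v
  rw [norm_div, norm_mul, norm_mul, norm_div, hG, hy']
  have hexp : Real.exp (1 - v ^ 2) = Real.exp 1 * Real.exp (-v ^ 2) := by
    rw [← Real.exp_add]; ring_nf
  rw [hexp]
  have hX0 : 0 ≤ ‖Complex.Gamma (s + (1 + v * I))‖ / ‖Complex.Gamma s‖ *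
      (Real.exp 1 * Real.exp (-v ^ 2)) * y⁻¹ := by positivity
  calc ‖Complex.Gamma (s + (1 + v * I))‖ / ‖Complex.Gamma s‖ * (Real.exp 1 * Real.exp (-v ^ 2)) *
        y⁻¹ / ‖(1 : ℂ) + v * I‖
      ≤ ‖Complex.Gamma (s + (1 + v * I))‖ / ‖Complex.Gamma s‖ * (Real.exp 1 * Real.exp (-v ^ 2)) *
        y⁻¹ / 1 := div_le_div_of_nonneg_left hX0 one_pos hu
    _ ≤ Real.Gamma (s.re + 1) / ‖Complex.Gamma s‖ * (Real.exp 1 * Real.exp (-v ^ 2)) * y⁻¹ / 1 := by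
        gcongr
    _ = _ := by rw [div_one]; ring

/-- The integrand of `V_s(y)` (7.14) is integrable on the line `u = 1 + iv` (`Re s > −1`, `y > 0`).
[cite: ConreyIwaniec2002, Proposition 7.1 (7.14)] -/
theorem integrable_afeV_integrand {s : ℂ} (hs : -1 < s.re) {y : ℝ} (hy : 0 < y) :
    Integrable fun v : ℝ ↦ Complex.Gamma (s + (1 + v * I)) / Complex.Gamma s * afeG (1 + v * I) *
        (y : ℂ) ^ (-(1 + v * I)) / (1 + v * I) := by
  set C : ℝ := Real.Gamma (s.re + 1) / ‖Complex.Gamma s‖ * Real.exp 1 * y⁻¹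
  have hg : Integrable fun v : ℝ ↦ C * Real.exp (-v ^ 2) := by
    have := (integrable_exp_neg_mul_sq (by norm_num : (0 : ℝ) < 1)).const_mul C
    simpa [neg_mul, one_mul] using this
  exact hg.mono' (continuous_afeV_integrand hs hy).aestronglyMeasurable
    (Eventually.of_forall fun v ↦ norm_afeV_integrand_le hs hy v)

/-- `∫ (integrand of V) dv = 2π V_s(y)` (the definition (7.14), cleared of its `1/2π`).
[cite: ConreyIwaniec2002, Proposition 7.1 (7.14)] -/
theorem integral_afeV_integrand (s : ℂ) (y : ℝ) :
    ∫ v : ℝ, Complex.Gamma (s + (1 + v * I)) / Complex.Gamma s * afeG (1 + v * I) *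
        (y : ℂ) ^ (-(1 + v * I)) / (1 + v * I) = 2 * Real.pi * afeV s y := by
  rw [afeV_eq, ← mul_assoc]
  have hπ : (2 * Real.pi : ℂ) ≠ 0 := by exact_mod_cast (by positivity : (2 : ℝ) * Real.pi ≠ 0)
  rw [mul_one_div_cancel hπ, one_mul]

variable (K) in
/-- **The `n`-th term on the line `u = 1+iv`**, rearranged:
`2Q^{s+u}Γ(s+u)G(u)u^{−1}·λ(n)n^{−(s+u)} = 2Q^sΓ(s)·λ(n)n^{−s}·[Γ(s+u)Γ(s)^{−1}G(u)(n/Q)^{−u}u^{−1}]`.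
[cite: ConreyIwaniec2002, Proposition 7.1 (7.12)–(7.14)] -/
theorem afe_term_eq (ψ : ClassGroup (𝓞 K) →* ℂˣ) {q : ℕ} (hq : 0 < q) {s : ℂ} (hs : 0 < s.re)
    {n : ℕ} (hn : n ≠ 0) (v : ℝ) :
    2 * (condQ q : ℂ) ^ (s + (1 + v * I)) * Complex.Gamma (s + (1 + v * I)) * afeG (1 + v * I) /
        (1 + v * I) * LSeries.term (twistCount K (classGroupCharIdealHom ψ)) (s + (1 + v * I)) n =
      (2 * (condQ q : ℂ) ^ s * Complex.Gamma s) *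
        LSeries.term (fun m ↦ twistCount K (classGroupCharIdealHom ψ) m) s n *
        (Complex.Gamma (s + (1 + v * I)) / Complex.Gamma s * afeG (1 + v * I) *
          (((n : ℝ) / condQ q : ℝ) : ℂ) ^ (-(1 + v * I)) / (1 + v * I)) := by
  have hQ : 0 < condQ q := condQ_pos hq
  have hQ0 : (condQ q : ℂ) ≠ 0 := by exact_mod_cast hQ.ne'
  have hn0 : (n : ℂ) ≠ 0 := Nat.cast_ne_zero.2 hn
  have hΓ : Complex.Gamma s ≠ 0 := Complex.Gamma_ne_zero_of_re_pos hs
  have hu : (1 : ℂ) + v * I ≠ 0 := one_add_mul_I_ne_zero v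
  have e1 : (condQ q : ℂ) ^ (s + (1 + v * I)) = (condQ q : ℂ) ^ s * (condQ q : ℂ) ^ (1 + v * I) :=
    Complex.cpow_add _ _ hQ0
  have e2 : (n : ℂ) ^ (s + (1 + v * I)) = (n : ℂ) ^ s * (n : ℂ) ^ (1 + v * I) :=
    Complex.cpow_add _ _ hn0
  have e3 : (((n : ℝ) / condQ q : ℝ) : ℂ) ^ (-(1 + v * I)) =
      ((n : ℂ) ^ (1 + v * I))⁻¹ * (condQ q : ℂ) ^ (1 + v * I) := by
    rw [div_ofReal_cpow_neg n.cast_nonneg hQ, Complex.cpow_neg, Complex.ofReal_natCast]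
  have h1 : (n : ℂ) ^ s ≠ 0 := Complex.cpow_ne_zero_iff.2 (Or.inl hn0)
  have h2 : (n : ℂ) ^ (1 + v * I) ≠ 0 := Complex.cpow_ne_zero_iff.2 (Or.inl hn0)
  rw [LSeries.term_of_ne_zero hn, LSeries.term_of_ne_zero hn, e1, e2, e3]
  field_simp

variable (K) in
/-- **Termwise Mellin–Barnes**: for `n ≥ 1`, `∫ (n-th term) dv = 2π · 2Q^sΓ(s) · λ(n)n^{−s}V_s(n/Q)`.
[cite: ConreyIwaniec2002, Proposition 7.1 (7.12)–(7.14)] -/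
theorem integral_afe_term (ψ : ClassGroup (𝓞 K) →* ℂˣ) {q : ℕ} (hq : 0 < q) {s : ℂ} (hs : 0 < s.re)
    (n : ℕ) :
    ∫ v : ℝ, 2 * (condQ q : ℂ) ^ (s + (1 + v * I)) * Complex.Gamma (s + (1 + v * I)) *
        afeG (1 + v * I) / (1 + v * I) *
        LSeries.term (twistCount K (classGroupCharIdealHom ψ)) (s + (1 + v * I)) n =
      2 * Real.pi * ((2 * (condQ q : ℂ) ^ s * Complex.Gamma s) *
        LSeries.term (fun m ↦ twistCount K (classGroupCharIdealHom ψ) m * afeV s (m / condQ q)) s n) := by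
  rcases eq_or_ne n 0 with rfl | hn
  · simp [LSeries.term_zero]
  simp_rw [afe_term_eq K ψ hq hs hn]
  rw [integral_const_mul, integral_afeV_integrand, LSeries.term_of_ne_zero hn,
    LSeries.term_of_ne_zero hn]
  ring

variable (K) in
/-- **Majorant of the `n`-th term**: `≤ 2Q^{Re s+1}Γ(Re s+1)·e·e^{−v²}·|λ(n)|n^{−Re s−1}`.
[cite: ConreyIwaniec2002, Proposition 7.1 (7.12)] -/
theorem norm_afe_term_le (ψ : ClassGroup (𝓞 K) →* ℂˣ) {q : ℕ} (hq : 0 < q) {s : ℂ} (hs : 0 < s.re)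
    (n : ℕ) (v : ℝ) :
    ‖2 * (condQ q : ℂ) ^ (s + (1 + v * I)) * Complex.Gamma (s + (1 + v * I)) *
        afeG (1 + v * I) / (1 + v * I) *
        LSeries.term (twistCount K (classGroupCharIdealHom ψ)) (s + (1 + v * I)) n‖ ≤
      2 * condQ q ^ (s.re + 1) * Real.Gamma (s.re + 1) * Real.exp 1 * Real.exp (-v ^ 2) *
        ‖LSeries.term (twistCount K (classGroupCharIdealHom ψ)) ((s.re + 1 : ℝ) : ℂ) n‖ := by
  have hQ : 0 < condQ q := condQ_pos hq
  have hG : ‖afeG (1 + v * I)‖ = Real.exp (1 - v ^ 2) := by simpa using norm_afeG 1 v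
  have hQn : ‖(condQ q : ℂ) ^ (s + (1 + (v : ℂ) * I))‖ = condQ q ^ (s.re + 1) := by
    rw [Complex.norm_cpow_eq_rpow_re_of_pos hQ]; simp
  have hterm : ‖LSeries.term (twistCount K (classGroupCharIdealHom ψ)) (s + (1 + v * I)) n‖ =
      ‖LSeries.term (twistCount K (classGroupCharIdealHom ψ)) ((s.re + 1 : ℝ) : ℂ) n‖ := by
    rw [LSeries.norm_term_eq, LSeries.norm_term_eq]; simp
  have hu := one_le_norm_one_add_mul_I v
  have hΓ := norm_Gamma_add_one_line_le (s := s) (by linarith) v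
  have hexp : Real.exp (1 - v ^ 2) = Real.exp 1 * Real.exp (-v ^ 2) := by
    rw [← Real.exp_add]; ring_nf
  rw [norm_mul, norm_div, norm_mul, norm_mul, norm_mul, hQn, hG, hterm, hexp, Complex.norm_ofNat]
  calc 2 * condQ q ^ (s.re + 1) * ‖Complex.Gamma (s + (1 + v * I))‖ * (Real.exp 1 * Real.exp (-v ^ 2)) /
        ‖(1 : ℂ) + v * I‖ * ‖LSeries.term (twistCount K (classGroupCharIdealHom ψ)) ((s.re + 1 : ℝ) : ℂ) n‖
      ≤ 2 * condQ q ^ (s.re + 1) * Real.Gamma (s.re + 1) * (Real.exp 1 * Real.exp (-v ^ 2)) / 1 *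
        ‖LSeries.term (twistCount K (classGroupCharIdealHom ψ)) ((s.re + 1 : ℝ) : ℂ) n‖ := by
        gcongr
    _ = _ := by rw [div_one]; ring

variable (K) in
/-- The `n`-th term is continuous in `v`. [folklore] -/
private theorem continuous_afe_term (ψ : ClassGroup (𝓞 K) →* ℂˣ) {q : ℕ} (hq : 0 < q) {s : ℂ} (hs : 0 < s.re)
    (n : ℕ) :
    Continuous fun v : ℝ ↦ 2 * (condQ q : ℂ) ^ (s + (1 + v * I)) * Complex.Gamma (s + (1 + v * I)) *
        afeG (1 + v * I) / (1 + v * I) *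
        LSeries.term (twistCount K (classGroupCharIdealHom ψ)) (s + (1 + v * I)) n := by
  have hQ : 0 < condQ q := condQ_pos hq
  have h1 := continuous_Gamma_add_one_line (s := s) (by linarith)
  have h2 : Continuous fun v : ℝ ↦ afeG (1 + v * I) := continuous_afeG.comp (by fun_prop)
  have h3 : Continuous fun v : ℝ ↦ (condQ q : ℂ) ^ (s + (1 + (v : ℂ) * I)) :=
    Continuous.const_cpow (by fun_prop) (Or.inl (by exact_mod_cast hQ.ne'))
  have h4 : Continuous fun v : ℝ ↦
      LSeries.term (twistCount K (classGroupCharIdealHom ψ)) (s + (1 + v * I)) n := by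
    rcases eq_or_ne n 0 with rfl | hn
    · simp [LSeries.term_zero]; exact continuous_const
    · simp_rw [LSeries.term_of_ne_zero hn]
      refine continuous_const.div (Continuous.const_cpow (by fun_prop) (Or.inl ?_)) fun v ↦ ?_
      · exact_mod_cast hn
      · exact Complex.cpow_ne_zero_iff.2 (Or.inl (by exact_mod_cast hn))
  refine (Continuous.div ?_ (by fun_prop) one_add_mul_I_ne_zero).mul h4
  exact ((continuous_const.mul h3).mul h1).mul h2

/-- **Unfolding on the line `Re u = 1`** (Re `s > 0`): with `Λ(w) = ξ(w,ψ)/(w(w−1)) = γ_K(w)L(w,ψ)`,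
`∫ Λ(s+1+iv) G(1+iv) (1+iv)^{−1} dv = 2π · γ_K(s) · A(s)` — expand `L` into its Dirichlet series
(absolutely convergent on `Re = Re s + 1 > 1`) and integrate termwise against the Gaussian majorant.
[cite: ConreyIwaniec2002, Proposition 7.1 (7.12)–(7.14)] -/
theorem integral_lineOne {q : ℕ} (h2 : Module.finrank ℚ K = 2) (hdisc : NumberField.discr K = -(q : ℤ))
    (ψ : ClassGroup (𝓞 K) →* ℂˣ) {s : ℂ} (hs : 0 < s.re) :
    ∫ v : ℝ, classXi K ψ (s + (1 + v * I)) / ((s + (1 + v * I)) * (s + (1 + v * I) - 1)) *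
        afeG (1 + v * I) / (1 + v * I) =
      2 * Real.pi * (dedekindGammaFactor K s * afeA K ψ q s) := by
  have hq : 0 < q := by
    rcases Nat.eq_zero_or_pos q with h | h
    · exfalso; exact NumberField.discr_ne_zero K (by rw [hdisc, h]; simp)
    · exact h
  have hQ : 0 < condQ q := condQ_pos hq
  set a : ℕ → ℂ := twistCount K (classGroupCharIdealHom ψ) with ha
  set T : ℕ → ℝ → ℂ := fun n v ↦ 2 * (condQ q : ℂ) ^ (s + (1 + v * I)) *
    Complex.Gamma (s + (1 + v * I)) * afeG (1 + v * I) / (1 + v * I) *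
    LSeries.term a (s + (1 + v * I)) n with hT
  -- pointwise: the integrand is `∑' n, T n v`
  have hpt : ∀ v : ℝ, classXi K ψ (s + (1 + v * I)) / ((s + (1 + v * I)) * (s + (1 + v * I) - 1)) *
      afeG (1 + v * I) / (1 + v * I) = ∑' n, T n v := by
    intro v
    have hwre : (s + (1 + v * I)).re = s.re + 1 := by simp
    have hw0 : 0 < (s + (1 + v * I)).re := by rw [hwre]; linarith
    have hw1 : s + (1 + v * I) ≠ 1 := fun h ↦ by
      have := congrArg Complex.re h; rw [hwre, Complex.one_re] at this; linarith
    have hw0' : s + (1 + v * I) ≠ 0 := fun h ↦ by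
      have := congrArg Complex.re h; rw [hwre, Complex.zero_re] at this; linarith
    have hw1' : s + (1 + v * I) - 1 ≠ 0 := sub_ne_zero.2 hw1
    have hL : classGroupLFunction K ψ (s + (1 + v * I)) = ∑' n, LSeries.term a (s + (1 + v * I)) n := by
      rw [← LSeries_twistCount_classGroupCharIdealHom K ψ (by rw [hwre]; linarith), LSeries]
    rw [classXi_eq_mul ψ hw0 hw1, dedekindGammaFactor_eq_condQ K h2 hdisc, hL,
      mul_div_cancel_left₀ _ (mul_ne_zero hw0' hw1')]
    have hTsum : ∑' n, T n v = (2 * (condQ q : ℂ) ^ (s + (1 + v * I)) *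
        Complex.Gamma (s + (1 + v * I)) * afeG (1 + v * I) / (1 + v * I)) *
        ∑' n, LSeries.term a (s + (1 + v * I)) n := by
      rw [hT]
      exact tsum_mul_left
    rw [hTsum]
    ring
  have hint : ∀ n, Integrable (T n) := fun n ↦ by
    have hg : Integrable fun v : ℝ ↦ 2 * condQ q ^ (s.re + 1) * Real.Gamma (s.re + 1) * Real.exp 1 *
        Real.exp (-v ^ 2) * ‖LSeries.term a ((s.re + 1 : ℝ) : ℂ) n‖ := by
      have := ((integrable_exp_neg_mul_sq (by norm_num : (0 : ℝ) < 1)).const_mul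
        (2 * condQ q ^ (s.re + 1) * Real.Gamma (s.re + 1) * Real.exp 1)).mul_const
        ‖LSeries.term a ((s.re + 1 : ℝ) : ℂ) n‖
      simpa [neg_mul, one_mul] using this
    exact hg.mono' (continuous_afe_term K ψ hq hs n).aestronglyMeasurable
      (Eventually.of_forall fun v ↦ norm_afe_term_le K ψ hq hs n v)
  set J : ℝ := ∫ v : ℝ, Real.exp (-v ^ 2) with hJ
  have hsum : Summable fun n ↦ ∫ v, ‖T n v‖ := by
    have hS : Summable fun n ↦ ‖LSeries.term a ((s.re + 1 : ℝ) : ℂ) n‖ :=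
      (LSeriesSummable_twistCount (K := K) (norm_classGroupCharIdealHom_le ψ)
        (s := ((s.re + 1 : ℝ) : ℂ)) (by simp; linarith)).norm
    refine Summable.of_nonneg_of_le (fun n ↦ integral_nonneg fun v ↦ norm_nonneg _) (fun n ↦ ?_)
      (hS.mul_left (2 * condQ q ^ (s.re + 1) * Real.Gamma (s.re + 1) * Real.exp 1 * J))
    have hgi : Integrable fun v : ℝ ↦ 2 * condQ q ^ (s.re + 1) * Real.Gamma (s.re + 1) * Real.exp 1 *
        Real.exp (-v ^ 2) * ‖LSeries.term a ((s.re + 1 : ℝ) : ℂ) n‖ := by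
      have := ((integrable_exp_neg_mul_sq (by norm_num : (0 : ℝ) < 1)).const_mul
        (2 * condQ q ^ (s.re + 1) * Real.Gamma (s.re + 1) * Real.exp 1)).mul_const
        ‖LSeries.term a ((s.re + 1 : ℝ) : ℂ) n‖
      simpa [neg_mul, one_mul] using this
    calc ∫ v, ‖T n v‖ ≤ ∫ v : ℝ, 2 * condQ q ^ (s.re + 1) * Real.Gamma (s.re + 1) * Real.exp 1 *
          Real.exp (-v ^ 2) * ‖LSeries.term a ((s.re + 1 : ℝ) : ℂ) n‖ :=
          integral_mono (hint n).norm hgi fun v ↦ norm_afe_term_le K ψ hq hs n v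
      _ = 2 * condQ q ^ (s.re + 1) * Real.Gamma (s.re + 1) * Real.exp 1 * J *
          ‖LSeries.term a ((s.re + 1 : ℝ) : ℂ) n‖ := by
          rw [integral_mul_const, integral_const_mul]
  have hval : ∀ n, ∫ v, T n v = 2 * Real.pi * ((2 * (condQ q : ℂ) ^ s * Complex.Gamma s) *
      LSeries.term (fun m ↦ a m * afeV s (m / condQ q)) s n) := fun n ↦
    integral_afe_term K ψ hq hs n
  calc ∫ v : ℝ, classXi K ψ (s + (1 + v * I)) / ((s + (1 + v * I)) * (s + (1 + v * I) - 1)) *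
        afeG (1 + v * I) / (1 + v * I)
      = ∫ v : ℝ, ∑' n, T n v := integral_congr_ae (Eventually.of_forall hpt)
    _ = ∑' n, ∫ v, T n v := (integral_tsum_of_summable_integral_norm hint hsum).symm
    _ = ∑' n, 2 * Real.pi * ((2 * (condQ q : ℂ) ^ s * Complex.Gamma s) *
          LSeries.term (fun m ↦ a m * afeV s (m / condQ q)) s n) := tsum_congr hval
    _ = 2 * Real.pi * (dedekindGammaFactor K s * afeA K ψ q s) := by
        rw [tsum_mul_left, tsum_mul_left, dedekindGammaFactor_eq_condQ K h2 hdisc, afeA, LSeries]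

end ConreyIwaniec2002

end Literature.NumberTheory.LFunctions

end
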